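import Summits.QuantumFields.BalabanUV.Beta.MixedWardSiteLaw
import Summits.QuantumFields.BalabanUV.Beta.D1BFx.FineStencilBF

/-!
# `BalabanUV.Beta.MixedWardPackingFF` — W2P-PACK: the packing adapter `mixKerAt_siteWard ⟹ divV Z u = comp (X u) Y − comp Y (X u)`
# for the three packings of an1's mixed averaging table on the field–field block (road «BF-x», binder row D1, rulings ρ-g9-15 ∕ ρ-g9-22)
HONEST DEPENDENCY (page 1, mandatory): continuum YM on T⁴ ⇐ BetaPertH ∧ nine spine estimates (0/9 proved); BetaPertH ⇐ (D1) ∧ (D4) ∧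
CAP+tail; G-an2-4 gates asym, D1 and NE2/3/4.  HONEST FRAMING (cell charter, verbatim): «discharging BetaPertH makes Balaban's UV stability
UNCONDITIONAL — a real constructive-QFT result; it is NOT the continuum limit and NOT the Clay problem.»  This file is [folklore] finite
bookkeeping over OUR OWN typed objects: it repacks an2-g21's landed SITE-LEVEL mixed Ward law `MixedWardSiteLaw.mixKerAt_siteWard`
(`Σ_κ (t(f,f′;(κ,u−e_κ)) − t(f,f′;(κ,u))) = 2·h(f,f′)·([u = L•y+ρ] − [u = x_f])`) into `KernelWard.divV` form for the three
packings of the mixed table on the field–field block.  Nothing of Bałaban's is asserted; TWO definitions with bodies ([our object] `mixSymAt`,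
`mixAsymAt`: the `trK`-symmetrised ∕ antisymmetrised packings; assert nothing); no `def … : Prop`; 0 cite; 0 sorry.  0 wall binders
(root-level hW ∕ hR-sockets ∕ hSX-socket ∕ D1Tel ∕ D1Rep — 0 discharged); (K) NOT closed; NOT D1, NOT `BetaPertH`, NOT continuum, NOT Clay.
ABSOLUTE RULE (cell charter, verbatim): «No internally-minted statement may enter as a cited fact. Every hypothesis is either kernel-proved in
this package or a verbatim quotation of a PUBLISHED theorem with page reference. The manuscript(s) under audit are NOT citable for their own
disputed steps — they are the thing under adjudication; programme-internal (2001/route/tribunal) claims are never citable.»  PACKING OF RECORD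
(owner ruling ρ-g9-22): `Z := Zs` (`mixSymAt`), generator `X u := diagK (−legInd ρ_c u)`; the raw ∕ antisymmetric packings stay as parity bookkeeping.
THE THREE PACKINGS (insertion `Y := hessFFAt ρ L μ y` = the rooted W-Hessian of the coarse bond `b = (μ, y)`, root `r := L•y + ρ`;
background bond `(κ, u)` varied; `D_u := diagK (legInd ρ u)` the diagonal generator, `= siteP u` on fluctuation legs):
* (P-raw)  `Z₀ κ u := mixFFAt ρ L κ u μ y` (an2's (Q-C1) packing):
  `divV Z₀ u = (2·[u = r]) • Y − 2 • (D_u ∘ Y)` — a ONE-SIDED generator plus a ROOT CONTACT; NOT a commutator (`divV_mixFFAt_eq`).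
* (P-sym)  `Zs κ u := ½ • (Z₀ κ u + (Z₀ κ u)ᵀ)` (`mixSymAt`, the `trK`-symmetrised packing):
  `divV Zs u = conjV Y D_u = Y ∘ D_u − D_u ∘ Y = comp (X u) Y − comp Y (X u)` with `X u := diagK (−legInd ρ u)` — THE ROAD's (W2′)
  SHAPE VERBATIM (`divV_mixSymAt_eq_conjV`, `divV_mixSymAt_eq_comm`); the root contact CANCELS by the antisymmetry of `Y`
  (`hessFFAt_antisymm`).
* (P-asym) `Za κ u := ½ • (Z₀ κ u − (Z₀ κ u)ᵀ)` (`mixAsymAt`): `divV Za u = (2·[u = r] − legInd x a − legInd x′ b) · Y` entrywise,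
  `trK`-ANTISYMMETRIC (`trK_divV_mixAsymAt`), hence invisible in a tadpole against a `trK`-symmetric kernel
  (`D1BFx/TadpoleParity.tadpole_eq_zero_of_symm`); `Z₀ = Zs + Za` (`mixFFAt_eq_sym_add_asym`).
§3: `ρ = 0` (`mixFF`, `hessFF`, `siteP`); §4: the road's `d = 3`, `ρ_c = toSite (ctrOff 4 Lc)` instances (tokens of `MixedWardPacking.datM`);
§5: the road's FIELD–FIELD BLOCK via `D1BFx/FineStencilBF.ffOf` (`Y := ffOf (hessFFAt ρ_c Lc m w)`, `X u := −ffOf (siteP u)` — ROOT-FREE —,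
`Z := fun κ v => ffOf (mixSymAt ρ_c Lc κ v m w)`): `w2p_sym_ff`, plus `BiLoc (X u) u u 1 δ`.  (If the courier prefers two files: §0–§4 import only
`Beta.MixedWardSiteLaw`; §5 additionally `D1BFx.FineStencilBF`.)

Provenance: β sub-cell; TYPED by unit b2b-balaban-beta-an1-g35 (planner seat, kernel-checked scratch `w2p/W2PPack.lean` sha16 03aebaac1991d32e,
2026-08-21); COURIERED to the tree with every declaration byte-identical by unit b2b-balaban-beta-d1-formalise-leaf-04 (gen 8, owner ruling ρ-g9-22).
-/

open Finset
open scoped BigOperators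
open Literature.MathematicalPhysics.QuantumFieldTheory
open Literature.MathematicalPhysics.QuantumFieldTheory.Balaban1983to89
open Literature.MathematicalPhysics.QuantumFieldTheory.Balaban1983to89.Beta
open AffineAveraging (toSite)
open AveragingContoursRooted (ctrOff)
open AveragingHessianKernels (Bond hessFF)
open AveragingHessianKernelsRooted (hessKerAt hessFFAt hessFFAt_inl_inl hessFFAt_inl_inr hessFFAt_inr hessFFAt_antisymm
  hessFFAt_zero)
open AveragingMixedJetTables (mixKerAt mixFFAt mixFFAt_inl_inl mixFFAt_inl_inr mixFFAt_inr mixFF)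
open ExpKernelCalculus (MKer comp)
open OneStepResolventKernel (Fib)
open KernelWard (divV)
open AveragingWardStencils (b6UnitVec_eq siteP)
open Summit.QuantumFields.BalabanUV.Beta.TameKernelCalculus (trK trK_apply)
open Summit.QuantumFields.BalabanUV.Beta.ChartConjugation (conjV)
open Summit.QuantumFields.BalabanUV.Beta.BorderedHessian (diagK diagK_apply comp_diagK_left comp_diagK_right conjV_diagK_apply)
open Summit.QuantumFields.BalabanUV.Beta.AveragingWardRootedStencils (legInd legInd_inl legInd_inr diagK_legInd_zero)
open Summit.QuantumFields.BalabanUV.Beta.MixedWardSiteLaw (mixKerAt_siteWard)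

namespace Summit.QuantumFields.BalabanUV.Beta.MixedWardPackingFF

noncomputable section

variable {d : ℕ}

/-! ## §0 Bookkeeping: `divV` entrywise and its linearity ∕ transpose on kernel families -/

/-- [folklore] `divV` entrywise. -/
theorem divV_apply (V : Fin (d + 1) → (Fin (d + 1) → ℤ) → MKer (d + 1) (Fib d)) (u x x' : Fin (d + 1) → ℤ) (a b : Fib d) :
    divV V u x x' a b = ∑ κ, (V κ (u - B6BondElimination.unitVec κ) x x' a b - V κ u x x' a b) := by
  simp only [KernelWard.divV, Finset.sum_apply, Pi.sub_apply]

/-- [folklore] `divV` is additive in the family. -/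
theorem divV_add (V W : Fin (d + 1) → (Fin (d + 1) → ℤ) → MKer (d + 1) (Fib d)) (u : Fin (d + 1) → ℤ) :
    divV (fun κ v => V κ v + W κ v) u = divV V u + divV W u := by
  funext x x' a b
  simp only [divV_apply, Pi.add_apply, ← Finset.sum_add_distrib]
  exact Finset.sum_congr rfl fun κ _ => by ring

/-- [folklore] `divV` is subtractive in the family. -/
theorem divV_sub (V W : Fin (d + 1) → (Fin (d + 1) → ℤ) → MKer (d + 1) (Fib d)) (u : Fin (d + 1) → ℤ) :
    divV (fun κ v => V κ v - W κ v) u = divV V u - divV W u := by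
  funext x x' a b
  simp only [divV_apply, Pi.sub_apply, ← Finset.sum_sub_distrib]
  exact Finset.sum_congr rfl fun κ _ => by ring

/-- [folklore] `divV` is homogeneous in the family. -/
theorem divV_smul (c : ℝ) (V : Fin (d + 1) → (Fin (d + 1) → ℤ) → MKer (d + 1) (Fib d)) (u : Fin (d + 1) → ℤ) :
    divV (fun κ v => c • V κ v) u = c • divV V u := by
  funext x x' a b
  simp only [divV_apply, Pi.smul_apply, smul_eq_mul, Finset.mul_sum]
  exact Finset.sum_congr rfl fun κ _ => by ring

/-- [folklore] `divV` commutes with the transpose `trK`. -/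
theorem divV_trK (V : Fin (d + 1) → (Fin (d + 1) → ℤ) → MKer (d + 1) (Fib d)) (u : Fin (d + 1) → ℤ) :
    divV (fun κ v => trK (V κ v)) u = trK (divV V u) := by
  funext x x' a b
  simp only [divV_apply, trK_apply]

/-- [folklore] Orientation of a site indicator. -/
private theorem ite_eq_comm (u x : Fin (d + 1) → ℤ) :
    (if u = x then (1 : ℝ) else 0) = (if x = u then (1 : ℝ) else 0) := by
  by_cases h : u = x
  · rw [if_pos h, if_pos h.symm]
  · rw [if_neg h, if_neg (fun h' => h h'.symm)]

/-! ## §1 (P-raw) The raw (Q-C1) packing `Z₀ κ u := mixFFAt ρ L κ u μ y`: one-sided generator + root contact -/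

/-- [folklore] **(P-raw) ON THE FIELD–FIELD BLOCK** — `mixKerAt_siteWard` read through the packer, site-law orientation:
`divV Z₀ u ((x, inl α), (x′, inl α′)) = 2 · h^ρ_b((α,x),(α′,x′)) · ([u = L•y + ρ] − [u = x])`. -/
theorem divV_mixFFAt_inl_inl {L : ℕ} (hL : L ≠ 0) (ρ : Fin (d + 1) → ℤ) (μ : Fin (d + 1)) (y u x x' : Fin (d + 1) → ℤ)
    (α α' : Fin (d + 1)) :
    divV (fun κ v => mixFFAt ρ L κ v μ y) u x x' (Sum.inl α) (Sum.inl α')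
      = 2 * hessKerAt ρ L μ y (α, x) (α', x')
          * ((if u = (L : ℤ) • y + ρ then (1 : ℝ) else 0) - (if u = x then (1 : ℝ) else 0)) := by
  simp only [divV_apply, mixFFAt_inl_inl, b6UnitVec_eq]
  exact mixKerAt_siteWard hL ρ μ y u (α, x) (α', x')

/-- [folklore] **(P-raw) ENTRYWISE, ALL BLOCKS** (generator orientation `legInd`): `divV Z₀ u x x′ a b =
2 · ([u = L•y + ρ] − legInd ρ u x a) · hessFFAt ρ L μ y x x′ a b` (both sides vanish off the field–field block). -/
theorem divV_mixFFAt_apply {L : ℕ} (hL : L ≠ 0) (ρ : Fin (d + 1) → ℤ) (μ : Fin (d + 1)) (y u x x' : Fin (d + 1) → ℤ)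
    (a b : Fib d) :
    divV (fun κ v => mixFFAt ρ L κ v μ y) u x x' a b
      = 2 * ((if u = (L : ℤ) • y + ρ then (1 : ℝ) else 0) - legInd ρ u x a) * hessFFAt ρ L μ y x x' a b := by
  rcases a with α | ν <;> rcases b with α' | ν'
  · rw [divV_mixFFAt_inl_inl hL, legInd_inl, hessFFAt_inl_inl, ite_eq_comm u x]; ring
  · simp [divV_apply]
  · simp [divV_apply]
  · simp [divV_apply]

/-- [folklore] **(P-raw) AS KERNELS**: `divV Z₀ u = (2·[u = L•y+ρ]) • Y − 2 • comp (diagK (legInd ρ u)) Y`, `Y := hessFFAt ρ L μ y` —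
a ONE-SIDED action of the generator plus a ROOT CONTACT: NOT of the commutator shape (W2′). -/
theorem divV_mixFFAt_eq {L : ℕ} (hL : L ≠ 0) (ρ : Fin (d + 1) → ℤ) (μ : Fin (d + 1)) (y u : Fin (d + 1) → ℤ) :
    divV (fun κ v => mixFFAt ρ L κ v μ y) u
      = (2 * (if u = (L : ℤ) • y + ρ then (1 : ℝ) else 0)) • hessFFAt ρ L μ y
          - (2 : ℝ) • comp (diagK (legInd ρ u)) (hessFFAt ρ L μ y) := by
  funext x x' a b
  simp only [Pi.sub_apply, Pi.smul_apply, smul_eq_mul]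
  rw [divV_mixFFAt_apply hL, comp_diagK_left]
  ring

/-! ## §2 (P-sym) ∕ (P-asym) The `trK`-symmetrised and -antisymmetrised packings -/

/-- [our object] **THE `trK`-SYMMETRISED PACKING** `Zs κ u := ½ • (Z₀ κ u + (Z₀ κ u)ᵀ)` of the mixed table (same argument order as `mixFFAt`). -/
def mixSymAt (ρ : Fin (d + 1) → ℤ) (L : ℕ) (κ : Fin (d + 1)) (u : Fin (d + 1) → ℤ) (μ : Fin (d + 1)) (y : Fin (d + 1) → ℤ) :
    MKer (d + 1) (Fib d) :=
  (1 / 2 : ℝ) • (mixFFAt ρ L κ u μ y + trK (mixFFAt ρ L κ u μ y))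

/-- [our object] **THE `trK`-ANTISYMMETRISED PACKING** `Za κ u := ½ • (Z₀ κ u − (Z₀ κ u)ᵀ)`. -/
def mixAsymAt (ρ : Fin (d + 1) → ℤ) (L : ℕ) (κ : Fin (d + 1)) (u : Fin (d + 1) → ℤ) (μ : Fin (d + 1)) (y : Fin (d + 1) → ℤ) :
    MKer (d + 1) (Fib d) :=
  (1 / 2 : ℝ) • (mixFFAt ρ L κ u μ y - trK (mixFFAt ρ L κ u μ y))

/-- [folklore] Entries of `mixSymAt`. -/
theorem mixSymAt_apply (ρ : Fin (d + 1) → ℤ) (L : ℕ) (κ : Fin (d + 1)) (u : Fin (d + 1) → ℤ) (μ : Fin (d + 1))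
    (y x x' : Fin (d + 1) → ℤ) (a b : Fib d) :
    mixSymAt ρ L κ u μ y x x' a b = (1 / 2 : ℝ) * (mixFFAt ρ L κ u μ y x x' a b + mixFFAt ρ L κ u μ y x' x b a) := rfl

/-- [folklore] Entries of `mixAsymAt`. -/
theorem mixAsymAt_apply (ρ : Fin (d + 1) → ℤ) (L : ℕ) (κ : Fin (d + 1)) (u : Fin (d + 1) → ℤ) (μ : Fin (d + 1))
    (y x x' : Fin (d + 1) → ℤ) (a b : Fib d) :
    mixAsymAt ρ L κ u μ y x x' a b = (1 / 2 : ℝ) * (mixFFAt ρ L κ u μ y x x' a b - mixFFAt ρ L κ u μ y x' x b a) := rfl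

/-- [folklore] `Z₀ = Zs + Za`. -/
theorem mixFFAt_eq_sym_add_asym (ρ : Fin (d + 1) → ℤ) (L : ℕ) (κ : Fin (d + 1)) (u : Fin (d + 1) → ℤ) (μ : Fin (d + 1))
    (y : Fin (d + 1) → ℤ) :
    mixFFAt ρ L κ u μ y = mixSymAt ρ L κ u μ y + mixAsymAt ρ L κ u μ y := by
  funext x x' a b
  rw [Pi.add_apply, Pi.add_apply, Pi.add_apply, Pi.add_apply, mixSymAt_apply, mixAsymAt_apply]
  ring

/-- [folklore] `Zs` is `trK`-symmetric. -/
theorem trK_mixSymAt (ρ : Fin (d + 1) → ℤ) (L : ℕ) (κ : Fin (d + 1)) (u : Fin (d + 1) → ℤ) (μ : Fin (d + 1))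
    (y : Fin (d + 1) → ℤ) : trK (mixSymAt ρ L κ u μ y) = mixSymAt ρ L κ u μ y := by
  funext x x' a b
  rw [trK_apply, mixSymAt_apply, mixSymAt_apply]
  ring

/-- [folklore] `Za` is `trK`-antisymmetric. -/
theorem trK_mixAsymAt (ρ : Fin (d + 1) → ℤ) (L : ℕ) (κ : Fin (d + 1)) (u : Fin (d + 1) → ℤ) (μ : Fin (d + 1))
    (y : Fin (d + 1) → ℤ) : trK (mixAsymAt ρ L κ u μ y) = -mixAsymAt ρ L κ u μ y := by
  funext x x' a b
  rw [trK_apply, Pi.neg_apply, Pi.neg_apply, Pi.neg_apply, Pi.neg_apply, mixAsymAt_apply, mixAsymAt_apply]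
  ring

/-- [folklore] **(P-sym) ENTRYWISE**: `divV Zs u x x′ a b = (legInd ρ u x′ b − legInd ρ u x a) · hessFFAt ρ L μ y x x′ a b` — the root
contact of (P-raw) CANCELS against its transpose by `hessFFAt_antisymm`. -/
theorem divV_mixSymAt_apply {L : ℕ} (hL : L ≠ 0) (ρ : Fin (d + 1) → ℤ) (μ : Fin (d + 1)) (y u x x' : Fin (d + 1) → ℤ)
    (a b : Fib d) :
    divV (fun κ v => mixSymAt ρ L κ v μ y) u x x' a b = (legInd ρ u x' b - legInd ρ u x a) * hessFFAt ρ L μ y x x' a b := by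
  have h1 := divV_mixFFAt_apply hL ρ μ y u x x' a b
  have h2 := divV_mixFFAt_apply hL ρ μ y u x' x b a
  rw [hessFFAt_antisymm ρ L μ y x x' a b] at h2
  have h : divV (fun κ v => mixSymAt ρ L κ v μ y) u
      = (1 / 2 : ℝ) • (divV (fun κ v => mixFFAt ρ L κ v μ y) u + trK (divV (fun κ v => mixFFAt ρ L κ v μ y) u)) := by
    rw [← divV_trK, ← divV_add, ← divV_smul]; rfl
  rw [h, Pi.smul_apply, Pi.smul_apply, Pi.smul_apply, Pi.smul_apply, smul_eq_mul, Pi.add_apply, Pi.add_apply, Pi.add_apply,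
    Pi.add_apply, trK_apply, h1, h2]
  ring

/-- [folklore] **(P-sym) AS A COMMUTATOR WITH THE DIAGONAL GENERATOR**: `divV Zs u = conjV Y (diagK (legInd ρ u)) = Y ∘ D_u − D_u ∘ Y`. -/
theorem divV_mixSymAt_eq_conjV {L : ℕ} (hL : L ≠ 0) (ρ : Fin (d + 1) → ℤ) (μ : Fin (d + 1)) (y u : Fin (d + 1) → ℤ) :
    divV (fun κ v => mixSymAt ρ L κ v μ y) u = conjV (hessFFAt ρ L μ y) (diagK (legInd ρ u)) := by
  funext x x' a b
  rw [conjV_diagK_apply, divV_mixSymAt_apply hL]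
  ring

/-- [folklore] **(P-sym) IN THE ROAD's (W2′) SHAPE VERBATIM** — `divV Z u = comp (X u) Y − comp Y (X u)` with `Y := hessFFAt ρ L μ y`,
`Z := fun κ v => mixSymAt ρ L κ v μ y`, `X u := diagK (fun z b => −legInd ρ u z b)` (MINUS the diagonal generator: the road puts `X` on the LEFT). -/
theorem divV_mixSymAt_eq_comm {L : ℕ} (hL : L ≠ 0) (ρ : Fin (d + 1) → ℤ) (μ : Fin (d + 1)) (y u : Fin (d + 1) → ℤ) :
    divV (fun κ v => mixSymAt ρ L κ v μ y) u
      = comp (diagK (fun z b => -legInd ρ u z b)) (hessFFAt ρ L μ y) - comp (hessFFAt ρ L μ y) (diagK (fun z b => -legInd ρ u z b)) := by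
  funext x x' a b
  rw [Pi.sub_apply, Pi.sub_apply, Pi.sub_apply, Pi.sub_apply, comp_diagK_left, comp_diagK_right, divV_mixSymAt_apply hL]
  ring

/-- [folklore] The same with the generator on the right: `divV Zs u = comp Y (diagK (legInd ρ u)) − comp (diagK (legInd ρ u)) Y`. -/
theorem divV_mixSymAt_eq_comm' {L : ℕ} (hL : L ≠ 0) (ρ : Fin (d + 1) → ℤ) (μ : Fin (d + 1)) (y u : Fin (d + 1) → ℤ) :
    divV (fun κ v => mixSymAt ρ L κ v μ y) u
      = comp (hessFFAt ρ L μ y) (diagK (legInd ρ u)) - comp (diagK (legInd ρ u)) (hessFFAt ρ L μ y) := by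
  rw [divV_mixSymAt_eq_conjV hL]; rfl

/-- [folklore] **(P-asym) ENTRYWISE**: `divV Za u x x′ a b = (2·[u = L•y+ρ] − legInd ρ u x a − legInd ρ u x′ b) · hessFFAt ρ L μ y x x′ a b` —
the root contact and the symmetrised one-sided action live here. -/
theorem divV_mixAsymAt_apply {L : ℕ} (hL : L ≠ 0) (ρ : Fin (d + 1) → ℤ) (μ : Fin (d + 1)) (y u x x' : Fin (d + 1) → ℤ)
    (a b : Fib d) :
    divV (fun κ v => mixAsymAt ρ L κ v μ y) u x x' a b
      = (2 * (if u = (L : ℤ) • y + ρ then (1 : ℝ) else 0) - legInd ρ u x a - legInd ρ u x' b) * hessFFAt ρ L μ y x x' a b := by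
  have h1 := divV_mixFFAt_apply hL ρ μ y u x x' a b
  have h2 := divV_mixFFAt_apply hL ρ μ y u x' x b a
  rw [hessFFAt_antisymm ρ L μ y x x' a b] at h2
  have h : divV (fun κ v => mixAsymAt ρ L κ v μ y) u
      = (1 / 2 : ℝ) • (divV (fun κ v => mixFFAt ρ L κ v μ y) u - trK (divV (fun κ v => mixFFAt ρ L κ v μ y) u)) := by
    rw [← divV_trK, ← divV_sub, ← divV_smul]; rfl
  rw [h, Pi.smul_apply, Pi.smul_apply, Pi.smul_apply, Pi.smul_apply, smul_eq_mul, Pi.sub_apply, Pi.sub_apply, Pi.sub_apply,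
    Pi.sub_apply, trK_apply, h1, h2]
  ring

/-- [folklore] **`divV Za u` IS `trK`-ANTISYMMETRIC** (so `tadpole A (divV Za u) = 0` for `trK A = A` by `D1BFx/TadpoleParity.tadpole_eq_zero_of_symm`,
given the tameness hypotheses there). -/
theorem trK_divV_mixAsymAt (ρ : Fin (d + 1) → ℤ) (L : ℕ) (μ : Fin (d + 1)) (y u : Fin (d + 1) → ℤ) :
    trK (divV (fun κ v => mixAsymAt ρ L κ v μ y) u) = -divV (fun κ v => mixAsymAt ρ L κ v μ y) u := by
  rw [← divV_trK]
  have h : (fun κ v => trK (mixAsymAt ρ L κ v μ y)) = fun κ v => (-1 : ℝ) • mixAsymAt ρ L κ v μ y := by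
    funext κ v; rw [trK_mixAsymAt, neg_one_smul]
  rw [h, divV_smul, neg_one_smul]

/-- [folklore] **THE DIVERGENCE OF THE RAW PACKING SPLITS**: `divV Z₀ u = divV Zs u + divV Za u` (commutator part + `trK`-antisymmetric remainder). -/
theorem divV_mixFFAt_eq_sym_add_asym {L : ℕ} (ρ : Fin (d + 1) → ℤ) (μ : Fin (d + 1)) (y u : Fin (d + 1) → ℤ) :
    divV (fun κ v => mixFFAt ρ L κ v μ y) u
      = divV (fun κ v => mixSymAt ρ L κ v μ y) u + divV (fun κ v => mixAsymAt ρ L κ v μ y) u := by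
  rw [← divV_add]
  congr 1
  funext κ v
  exact mixFFAt_eq_sym_add_asym ρ L κ v μ y

/-! ## §3 `ρ = 0`: node 7a's `hessFF`, an2's `mixFF d L := mixFFAt 0 L`, node 8b's site projector `siteP` -/

/-- [folklore] **(P-sym) AT THE BASE ROOT**: `divV (½ • (mixFF + mixFFᵀ)) u = conjV (hessFF L μ y) (siteP u)`. -/
theorem divV_mixSym_zero_eq_conjV {L : ℕ} (hL : L ≠ 0) (μ : Fin (d + 1)) (y u : Fin (d + 1) → ℤ) :
    divV (fun κ v => mixSymAt (0 : Fin (d + 1) → ℤ) L κ v μ y) u = conjV (hessFF L μ y) (siteP u) := by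
  rw [← hessFFAt_zero, ← diagK_legInd_zero]
  exact divV_mixSymAt_eq_conjV hL 0 μ y u

/-- [folklore] The base-root symmetrised packing unfolded over `mixFF` (definitional). -/
theorem mixSymAt_zero (L : ℕ) (κ : Fin (d + 1)) (u : Fin (d + 1) → ℤ) (μ : Fin (d + 1)) (y : Fin (d + 1) → ℤ) :
    mixSymAt (0 : Fin (d + 1) → ℤ) L κ u μ y = (1 / 2 : ℝ) • (mixFF d L κ u μ y + trK (mixFF d L κ u μ y)) := rfl

/-- [folklore] **(P-sym) AT THE BASE ROOT, (W2′) SHAPE**: `X u := diagK (−legInd 0 u)` (`= −siteP u` by `diagK_legInd_zero`), `Y := hessFF L μ y`. -/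
theorem divV_mixSym_zero_eq_comm {L : ℕ} (hL : L ≠ 0) (μ : Fin (d + 1)) (y u : Fin (d + 1) → ℤ) :
    divV (fun κ v => mixSymAt (0 : Fin (d + 1) → ℤ) L κ v μ y) u
      = comp (diagK (fun z b => -legInd 0 u z b)) (hessFF L μ y) - comp (hessFF L μ y) (diagK (fun z b => -legInd 0 u z b)) := by
  rw [← hessFFAt_zero]
  exact divV_mixSymAt_eq_comm hL 0 μ y u

/-! ## §4 The road's instance: `d = 3`, block `Lc`, root `ρ_c = toSite (ctrOff 4 Lc)` (tokens of `MixedWardPacking.datM`) -/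

section Road

variable {Lc : ℕ} [NeZero Lc]

/-- [folklore] **W2P-PACK, (P-sym), ROAD TOKENS**: for the coarse bond `(m, w)` and every varied fine site `u`,
`divV (fun κ v => mixSymAt ρ_c Lc κ v m w) u = comp (X u) Y − comp Y (X u)`,
`Y := hessFFAt ρ_c Lc m w`, `X u := diagK (fun z b => −legInd ρ_c u z b)`. -/
theorem w2p_sym (m : Fin (3 + 1)) (w u : Fin (3 + 1) → ℤ) :
    divV (fun κ v => mixSymAt (toSite (ctrOff 4 Lc)) Lc κ v m w) u
      = comp (diagK (fun z b => -legInd (toSite (ctrOff 4 Lc)) u z b)) (hessFFAt (toSite (ctrOff 4 Lc)) Lc m w)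
        - comp (hessFFAt (toSite (ctrOff 4 Lc)) Lc m w) (diagK (fun z b => -legInd (toSite (ctrOff 4 Lc)) u z b)) :=
  divV_mixSymAt_eq_comm (NeZero.ne Lc) _ m w u

/-- [folklore] **W2P-PACK, (P-raw), ROAD TOKENS**: the raw (Q-C1) packing carries the root contact:
`divV (fun κ v => mixFFAt ρ_c Lc κ v m w) u = (2·[u = Lc•w + ρ_c]) • Y − 2 • comp (diagK (legInd ρ_c u)) Y`. -/
theorem w2p_raw (m : Fin (3 + 1)) (w u : Fin (3 + 1) → ℤ) :
    divV (fun κ v => mixFFAt (toSite (ctrOff 4 Lc)) Lc κ v m w) u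
      = (2 * (if u = (Lc : ℤ) • w + toSite (ctrOff 4 Lc) then (1 : ℝ) else 0)) • hessFFAt (toSite (ctrOff 4 Lc)) Lc m w
        - (2 : ℝ) • comp (diagK (legInd (toSite (ctrOff 4 Lc)) u)) (hessFFAt (toSite (ctrOff 4 Lc)) Lc m w) :=
  divV_mixFFAt_eq (NeZero.ne Lc) _ m w u

omit [NeZero Lc] in
/-- [folklore] **W2P-PACK, (P-asym), ROAD TOKENS**: the remainder family's divergence is `trK`-antisymmetric. -/
theorem w2p_asym_trK (m : Fin (3 + 1)) (w u : Fin (3 + 1) → ℤ) :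
    trK (divV (fun κ v => mixAsymAt (toSite (ctrOff 4 Lc)) Lc κ v m w) u)
      = -divV (fun κ v => mixAsymAt (toSite (ctrOff 4 Lc)) Lc κ v m w) u :=
  trK_divV_mixAsymAt _ Lc m w u

end Road

/-! ## §5 The road's field–field block (`d = 3`): `ffOf` transports (P-sym) verbatim; the block generator is root-free -/

section FF

open Summit.QuantumFields.BalabanUV.Beta.D1BFx.FineStencilBF (ffOf ffOf_apply ffOf_sub ffOf_neg)
open ExpKernelCalculus (BiLoc)

/-- [folklore] `ffOf` commutes with `divV`. -/
theorem ffOf_divV (V : Fin (3 + 1) → (Fin (3 + 1) → ℤ) → MKer (3 + 1) (Fib 3)) (u : Fin (3 + 1) → ℤ) :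
    ffOf (divV V u) = divV (fun κ v => ffOf (V κ v)) u := by
  funext x z α β
  simp only [ffOf_apply, KernelWard.divV, Finset.sum_apply, Pi.sub_apply]

/-- [folklore] `ffOf` is multiplicative on a composition whose LEFT factor has no field–multiplier entries. -/
theorem ffOf_comp_of_left {A : MKer (3 + 1) (Fib 3)}
    (hA : ∀ (x y : Fin (3 + 1) → ℤ) (α m : Fin (3 + 1)), A x y (Sum.inl α) (Sum.inr m) = 0) (K : MKer (3 + 1) (Fib 3)) :
    ffOf (comp A K) = comp (ffOf A) (ffOf K) := by
  funext x z α β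
  simp only [ffOf_apply, ExpKernelCalculus.comp, Fintype.sum_sum_type, hA, zero_mul, Finset.sum_const_zero, add_zero]

/-- [folklore] `ffOf` is multiplicative on a composition whose RIGHT factor has no multiplier–field entries. -/
theorem ffOf_comp_of_right (A : MKer (3 + 1) (Fib 3)) {K : MKer (3 + 1) (Fib 3)}
    (hK : ∀ (y z : Fin (3 + 1) → ℤ) (m β : Fin (3 + 1)), K y z (Sum.inr m) (Sum.inl β) = 0) :
    ffOf (comp A K) = comp (ffOf A) (ffOf K) := by
  funext x z α β
  simp only [ffOf_apply, ExpKernelCalculus.comp, Fintype.sum_sum_type, hK, mul_zero, Finset.sum_const_zero, add_zero]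

/-- [folklore] A diagonal kernel has no `(inl, inr)` entries. -/
theorem diagK_inl_inr (g : (Fin (d + 1) → ℤ) → Fib d → ℝ) (x y : Fin (d + 1) → ℤ) (α m : Fin (d + 1)) :
    diagK g x y (Sum.inl α) (Sum.inr m) = 0 := by
  simp [diagK_apply]

/-- [folklore] A diagonal kernel has no `(inr, inl)` entries. -/
theorem diagK_inr_inl (g : (Fin (d + 1) → ℤ) → Fib d → ℝ) (x y : Fin (d + 1) → ℤ) (m α : Fin (d + 1)) :
    diagK g x y (Sum.inr m) (Sum.inl α) = 0 := by
  simp [diagK_apply]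

/-- [folklore] **THE FIELD-BLOCK GENERATOR IS ROOT-FREE**: `ffOf (diagK (legInd ρ u)) = ffOf (siteP u)` for EVERY root `ρ` (fluctuation legs act
at their own site, `legInd_inl`; the root enters `legInd` only on multiplier legs, which `ffOf` discards). -/
theorem ffOf_diagK_legInd (ρ u : Fin (3 + 1) → ℤ) : ffOf (diagK (legInd ρ u)) = ffOf (siteP u) := by
  rw [← diagK_legInd_zero]
  funext x z α β
  simp only [ffOf_apply, diagK_apply, legInd_inl]

/-- [folklore] The road's generator: `ffOf (diagK (−legInd ρ u)) = −ffOf (siteP u)`. -/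
theorem ffOf_diagK_neg_legInd (ρ u : Fin (3 + 1) → ℤ) : ffOf (diagK (fun z b => -legInd ρ u z b)) = -ffOf (siteP u) := by
  rw [← ffOf_diagK_legInd ρ u]
  funext x z α β
  simp only [ffOf_apply, Pi.neg_apply, diagK_apply, legInd_inl]
  split_ifs <;> simp

/-- [folklore] The road's generator is bi-localised at `(u, u)` with constant `1`, for every rate `δ`. -/
theorem biLoc_neg_ffOf_siteP (u : Fin (3 + 1) → ℤ) (δ : ℝ) : BiLoc (-ffOf (siteP u)) u u 1 δ := by
  intro x z α β
  simp only [Pi.neg_apply, ffOf_apply, AveragingWardStencils.siteP_apply, abs_neg]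
  split_ifs with h
  · obtain ⟨rfl, rfl, -⟩ := h
    simp [B12Sec2to5.l1]
  · rw [abs_zero]; positivity

variable {Lc : ℕ} [NeZero Lc]

/-- [folklore] **W2P-PACK ON THE ROAD's FIELD–FIELD BLOCK, (W2′) VERBATIM**: for the coarse bond `(m, w)` and every varied fine site `u`,
`ffOf (divV Zs u) = comp (X u) Y − comp Y (X u)` with `Y := ffOf (hessFFAt ρ_c Lc m w)`, `X u := −ffOf (siteP u)` (ROOT-FREE),
`Zs := fun κ v => mixSymAt ρ_c Lc κ v m w`. -/
theorem ffOf_w2p_sym (m : Fin (3 + 1)) (w u : Fin (3 + 1) → ℤ) :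
    ffOf (divV (fun κ v => mixSymAt (toSite (ctrOff 4 Lc)) Lc κ v m w) u)
      = comp (-ffOf (siteP u)) (ffOf (hessFFAt (toSite (ctrOff 4 Lc)) Lc m w))
        - comp (ffOf (hessFFAt (toSite (ctrOff 4 Lc)) Lc m w)) (-ffOf (siteP u)) := by
  rw [w2p_sym, ffOf_sub, ffOf_comp_of_left (diagK_inl_inr _), ffOf_comp_of_right _ (diagK_inr_inl _), ffOf_diagK_neg_legInd]

/-- [folklore] **THE SAME WITH THE PACKED FAMILY `Z := fun κ v => ffOf (Zs κ v)`** — the road's `hW2` binder of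
`D1BFx/KernelWardInsertion.ward_insertion` ∕ `KernelWardInsertionZero.tsum_resp_eq_zero` at `Y := ffOf (hessFFAt ρ_c Lc m w)`, `X u := −ffOf (siteP u)`. -/
theorem w2p_sym_ff (m : Fin (3 + 1)) (w u : Fin (3 + 1) → ℤ) :
    divV (fun κ v => ffOf (mixSymAt (toSite (ctrOff 4 Lc)) Lc κ v m w)) u
      = comp (-ffOf (siteP u)) (ffOf (hessFFAt (toSite (ctrOff 4 Lc)) Lc m w))
        - comp (ffOf (hessFFAt (toSite (ctrOff 4 Lc)) Lc m w)) (-ffOf (siteP u)) :=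
  (ffOf_divV _ u).symm.trans (ffOf_w2p_sym m w u)

/-- [folklore] `ρ = 0` ∕ `hessFF` reading of the field block (the owner's literal `Y := ffOf (hessFF n m y)`): for `n ≠ 0`,
`divV (fun κ v => ffOf (mixSymAt 0 n κ v m y)) u = comp (−ffOf (siteP u)) (ffOf (hessFF n m y)) − comp (ffOf (hessFF n m y)) (−ffOf (siteP u))`. -/
theorem w2p_sym_ff_zero {n : ℕ} (hn : n ≠ 0) (m : Fin (3 + 1)) (y u : Fin (3 + 1) → ℤ) :
    divV (fun κ v => ffOf (mixSymAt (0 : Fin (3 + 1) → ℤ) n κ v m y)) u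
      = comp (-ffOf (siteP u)) (ffOf (hessFF n m y)) - comp (ffOf (hessFF n m y)) (-ffOf (siteP u)) := by
  rw [← ffOf_divV, divV_mixSymAt_eq_comm hn, hessFFAt_zero, ffOf_sub, ffOf_comp_of_left (diagK_inl_inr _),
    ffOf_comp_of_right _ (diagK_inr_inl _), ffOf_diagK_neg_legInd]

end FF

end

end Summit.QuantumFields.BalabanUV.Beta.MixedWardPackingFF
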